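import Summits.Ventures.LatticeQCDFlow.Scaling.StarOccupationComparison
import Summits.Ventures.LatticeQCDFlow.Scaling.FiniteOddsAdjacentLaw

/-!
HONEST FRAMING: exact (Metropolis-corrected) sampling algorithms for lattice gauge theory; figures
of merit are autocorrelation/cost numbers at stated couplings and volumes; no continuum-physics
claim.

# FiniteOddsDominationCriterion — FOR AN ADJACENT EQUAL-HUB PAIR, DOMINATION OF THE TAGGED TAIL LAWS GIVES THE TWO PER-PAIR HYPOTHESES OF THE PATH-COUPLING LAW (CHAPTER W FILE
# 19, `finiteOdds_adjacent_worstTvDist_le'`) WITH THE OPTIMAL COUPLING OF THE END-HUB TAIL LAWS: IT IS MONOTONE (`Δ' ≤ Δ` ON ITS SUPPORT) AND THE PERSISTENCE INEQUALITY `hpers`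
# HOLDS WITH `ρ = 2σ·pE_{μ_0}[Wθ]/(c+2K+2)` FOR EVERY CONSTANT `c ≥ 2K+2` (lean-2 GEN-37, ours)

Venture-side (OURS).  Cell `lqcd-flow` (pub-lqcd), unit `pub-lqcd-lean-2-g37`, 2026-08-29.  Chapter W (item 1 (i) at finite swap odds), file 22 = files 16, 20, 21 joined to chapter V
file 2's optimal coupling: for the adjacent pair `N_X = N_C + δ_a`, `N_Y = N_C + δ_b` (`W_b ≤ W_a`, common ordinary hub `z`) with tagged tail laws `x̃`, `ỹ` (from `z`) and `x̃_★`, `ỹ_★`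
(from ★) and content tail laws `ũ_X`, `ũ_Y` (push-forwards), under DOMINATION — `ỹ(w) ≤ x̃(w)` for all ordinary `w` and `ỹ_★(z) ≤ x̃_★(z)`: (i) the LPW-4.7 optimal coupling of
`(ũ_X,ũ_Y)` only moves mass off the diagonal INTO `b` on the `Y` side, so `Δ' ≤ Δ` on its support (`adjacent_optimal_monotone`); (ii) its `Δ`-drift is the gain `G`
(chapter V file 2) and, by file 21, `cost_X + cost_Y ≤ G·(2K+M_X+M_Y)`; with `F = c − 2(1−σ)θ_z + M_X + M_Y ≤ c+2K+2`, `e = 2(1−σ)θ_z + 2σθ̄`, `c ≥ 2K+2` this is the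
persistence inequality of chapter W file 7 with `ρ = 2σ·pE_{μ_0}[Wθ]/(c+2K+2)` (`adjacent_hpers_of_domination`).  So the law `d(n) ≤ ((K+1)(c+2K+2) + 2(K+1)(c+2K+6))(1−ρ)ⁿ`
of file 19 holds as soon as every adjacent equal-hub pair satisfies the two domination statements — MEMO-gen37's Conjecture M.  Hypothesis-equations, no definitions.

## What is proved

* `adjacent_content_domination` (tagged domination ⇒ `ũ_Y(w) ≤ ũ_X(w)` for `w ≠ b`), **`adjacent_optimal_monotone`**, `adjacent_cdist_eq_one`,
  **`adjacent_hpers_of_domination`**.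

Reading (no numerics implied): the last plumbing step of the GEN-37 reduction.  NOT CLAIMED: domination.  Literature grade (cell rule): OWN, elementary on the tree's LPW files;
nothing cited as a fact; no new bib keys.
-/

open Finset
open Literature.Probability.MarkovChains

namespace Summit.Ventures.LatticeQCDFlow.Scaling

section DominationCriterion
variable {S : Type*} [Fintype S] [DecidableEq S]
variable {W θ μ0 : S → ℝ} {acc : S → S → ℝ} {p σ c : ℝ} {K : ℕ} {NC NX NY : S → ℕ} {a b z : S}
variable {PX PY : Option S → Option S → ℝ} {KX KY : S → S → ℝ} {xt yt xs ys : Option S → ℝ} {utX utY : S → ℝ} {Δ : (S → ℕ) → (S → ℕ) → ℕ}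

omit [Fintype S] in
/-- Tagged domination gives content domination off `b`: `ũ_Y(w) ≤ ũ_X(w)` for `w ≠ b`. [ours] -/
theorem adjacent_content_domination
    (hlX : ∀ w, utX w = xt (some w) + (if w = a then xt none else 0)) (hlY : ∀ w, utY w = yt (some w) + (if w = b then yt none else 0))
    (hxt0 : 0 ≤ xt none) (hdom : ∀ w, yt (some w) ≤ xt (some w)) {w : S} (hw : w ≠ b) : utY w ≤ utX w := by
  rw [hlX w, hlY w, if_neg hw, add_zero]
  by_cases hwa : w = a
  · rw [if_pos hwa]; linarith [hdom w]
  · rw [if_neg hwa, add_zero]; exact hdom w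

/-- **THE OPTIMAL COUPLING OF AN ADJACENT PAIR IS MONOTONE UNDER DOMINATION:** its support is contained in `{Δ' ≤ Δ}` (off the diagonal it charges only pairs `(α, b)`). [ours] -/
theorem adjacent_optimal_monotone (hΔ : ∀ N N', Δ N N' = ∑ v, (N v - N' v)) (hab : a ≠ b) (hX : NX = NC + Pi.single a 1) (hY : NY = NC + Pi.single b 1)
    (hlX : ∀ w, utX w = xt (some w) + (if w = a then xt none else 0)) (hlY : ∀ w, utY w = yt (some w) + (if w = b then yt none else 0))
    (hxt0 : 0 ≤ xt none) (hdom : ∀ w, yt (some w) ≤ xt (some w)) (hlegX : ∀ w, utX w ≠ 0 → NX w ≠ 0) (hlegY : ∀ w, utY w ≠ 0 → NY w ≠ 0)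
    (hu0X : ∀ w, 0 ≤ utX w) (hu0Y : ∀ w, 0 ≤ utY w)
    (α β : S) (hne : optimalCoupling utX utY α β ≠ 0) : Δ (NX - Pi.single α 1) (NY - Pi.single β 1) ≤ Δ NX NY := by
  classical
  -- the survivors
  by_cases hαβ : α = β
  · subst hαβ
    -- diagonal: both delete the same content; `optimalCoupling α α = min ≠ 0` forces legality in both
    have hXa : NX α ≠ 0 := by
      apply hlegX; intro h0; apply hne
      rw [optimalCoupling_self, h0, min_eq_left (hu0Y α)]
    have hYa : NY α ≠ 0 := by
      apply hlegY; intro h0; apply hne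
      rw [optimalCoupling_self, h0, min_eq_right (hu0X α)]
    have e := cdist_add_single_same hΔ (NX - Pi.single α 1) (NY - Pi.single α 1) α
    rw [← urnChain_survivor NX hXa, ← urnChain_survivor NY hYa] at e
    exact le_of_eq e.symm
  · -- off-diagonal: `ũ_Y(α) < ũ_X(α)` and `ũ_X(β) < ũ_Y(β)`, so `β = b` by domination
    have hsupp := optimalCoupling_offDiag_support hαβ hne
    have hβ : β = b := by
      by_contra hβb
      have := adjacent_content_domination hlX hlY hxt0 hdom hβb
      linarith [hsupp.2]
    subst hβ
    -- legality: `ũ_X(α) > ũ_Y(α) ≥ 0`, `ũ_Y(β) > 0`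
    have hXα : NX α ≠ 0 := hlegX α (by linarith [hsupp.1, hu0Y α])
    have hYβ : NY β ≠ 0 := hlegY β (by linarith [hsupp.2, hu0X β])
    -- `Δ(N_X − δ_α, N_Y − δ_b) + [..] = Δ + [N_Y(α) ≤ N_X(α) − 1]`… use chapter V file 1 on the survivors
    have e := cdist_add_single_add_single hΔ (NX - Pi.single α 1) (NY - Pi.single β 1) hαβ
    rw [← urnChain_survivor NX hXα, ← urnChain_survivor NY hYβ] at e
    -- `N_X(β) = N_C(β) < N_Y(β) = N_C(β)+1`: the indicator on the left is `1`… compute both indicators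
    have hNXb : NX β = NC β := by rw [hX]; simp [Ne.symm hab]
    have hNYb : NY β = NC β + 1 := by rw [hY]; simp
    have h1 : ¬ ((NY - Pi.single β 1 : S → ℕ) β + 1 ≤ (NX - Pi.single α 1 : S → ℕ) β) := by
      simp only [Pi.sub_apply, Pi.single_apply, if_true, if_neg (Ne.symm hαβ)]
      rw [hNXb, hNYb]; omega
    rw [if_neg h1] at e
    have h2 : 0 ≤ (if (NY - Pi.single β 1 : S → ℕ) α ≤ (NX - Pi.single α 1 : S → ℕ) α then 1 else 0 : ℕ) := Nat.zero_le _
    omega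

omit [DecidableEq S] in
/-- The distance of an adjacent pair is one: `Δ(N_C + δ_a, N_C + δ_b) = 1` (`a ≠ b`). [ours] -/
theorem adjacent_cdist_eq_one [DecidableEq S] (hΔ : ∀ N N', Δ N N' = ∑ v, (N v - N' v)) (hab : a ≠ b) (hX : NX = NC + Pi.single a 1) (hY : NY = NC + Pi.single b 1) :
    Δ NX NY = 1 := by
  have e := cdist_add_single_add_single hΔ NC NC hab
  rw [cdist_self hΔ NC, ← hX, ← hY] at e
  have h1 : ¬ (NC b + 1 ≤ NC b) := by omega
  rw [if_neg h1, if_pos le_rfl] at e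
  omega

set_option maxHeartbeats 400000 in
/-- **THE PERSISTENCE INEQUALITY `hpers` OF CHAPTER W FILES 7∕19 FOR AN ADJACENT PAIR, FROM DOMINATION,** with the optimal coupling of the end-hub tail laws, any constant
`c ≥ 2K+2` in `Φ = c − 2(1−σ)θ_z + M_X + M_Y`, and any rate `ρ ≥ 0` with `ρ(c+2K+2) ≤ 2σ·pE_{μ_0}[Wθ]`. [ours] -/
theorem adjacent_hpers_of_domination (hΔ : ∀ N N', Δ N N' = ∑ v, (N v - N' v))
    (hW : ∀ v, 0 < W v) (hp0 : 0 ≤ p) (hp : ∀ v, p * W v ≤ 1) (hθ : ∀ v, θ v = 1 / (1 + p * W v))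
    (hacc : ∀ h v, acc h v = min 1 (W h / W v)) (hK : 1 ≤ K) (hNC : ∑ v, NC v = K) (hab : a ≠ b) (hWab : W b ≤ W a)
    (hX : NX = NC + Pi.single a 1) (hY : NY = NC + Pi.single b 1) (hz : NC z ≠ 0)
    (hPXoff : ∀ h v, h ≠ v → PX (some h) (some v) = if NC h = 0 then 0 else (NC v : ℝ) / K * acc h v)
    (hPXin : ∀ h, PX (some h) none = if NC h = 0 then 0 else acc h a / K)
    (hPXdiag : ∀ h, PX (some h) (some h) = 1 - (∑ v ∈ univ.erase h, PX (some h) (some v) + PX (some h) none))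
    (hPXout : ∀ v, PX none (some v) = (NC v : ℝ) / K * acc a v) (hPXstay : PX none none = 1 - ∑ v, PX none (some v))
    (hPYoff : ∀ h v, h ≠ v → PY (some h) (some v) = if NC h = 0 then 0 else (NC v : ℝ) / K * acc h v)
    (hPYin : ∀ h, PY (some h) none = if NC h = 0 then 0 else acc h b / K)
    (hPYdiag : ∀ h, PY (some h) (some h) = 1 - (∑ v ∈ univ.erase h, PY (some h) (some v) + PY (some h) none))
    (hPYout : ∀ v, PY none (some v) = (NC v : ℝ) / K * acc b v) (hPYstay : PY none none = 1 - ∑ v, PY none (some v))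
    (hKXoff : ∀ h v, h ≠ v → KX h v = if NX h = 0 then 0 else (NX v : ℝ) / K * acc h v) (hKXdiag : ∀ h, KX h h = 1 - ∑ v ∈ univ.erase h, KX h v)
    (hKYoff : ∀ h v, h ≠ v → KY h v = if NY h = 0 then 0 else (NY v : ℝ) / K * acc h v) (hKYdiag : ∀ h, KY h h = 1 - ∑ v ∈ univ.erase h, KY h v)
    (hσ0 : 0 ≤ σ) (hσ1 : σ < 1)
    (hxt : ∀ t, xt t = (1 - σ) * PX (some z) t + σ * ∑ t', xt t' * PX t' t) (hyt : ∀ t, yt t = (1 - σ) * PY (some z) t + σ * ∑ t', yt t' * PY t' t)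
    (hxs : ∀ t, xs t = (1 - σ) * PX none t + σ * ∑ t', xs t' * PX t' t) (hys : ∀ t, ys t = (1 - σ) * PY none t + σ * ∑ t', ys t' * PY t' t)
    (hutX : ∀ w, utX w = (1 - σ) * KX z w + σ * ∑ h, utX h * KX h w) (hutY : ∀ w, utY w = (1 - σ) * KY z w + σ * ∑ h, utY h * KY h w)
    (hu0X : ∀ w, 0 ≤ utX w) (hu0Y : ∀ w, 0 ≤ utY w) (hu1X : ∑ w, utX w = 1) (hu1Y : ∑ w, utY w = 1)
    (hlegX : ∀ w, utX w ≠ 0 → NX w ≠ 0) (hlegY : ∀ w, utY w ≠ 0 → NY w ≠ 0)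
    (hdom : ∀ w, yt (some w) ≤ xt (some w)) (hDstar : ys (some z) ≤ xs (some z))
    {Φ ρ : ℝ} (hΦ : Φ = c + (-(1 - σ) * θ z) + (-(1 - σ) * θ z) + ∑ v, θ v * ((NX v : ℝ) + (NY v : ℝ))) (hc : 2 * (K : ℝ) + 2 ≤ c)
    (hρ0 : 0 ≤ ρ) (hρ : ρ * (c + 2 * K + 2) ≤ 2 * σ * (p * ∑ v, μ0 v * (W v * θ v))) (hμ0 : ∀ v, 0 ≤ μ0 v) :
    ρ * (Δ NX NY : ℝ) * Φ
      ≤ σ * (((Δ NX NY : ℝ) - ∑ a', ∑ b', optimalCoupling utX utY a' b' * (Δ (NX - Pi.single a' 1) (NY - Pi.single b' 1) : ℝ))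
            * (Φ + (2 * (1 - σ) * θ z + 2 * σ * ∑ v, μ0 v * θ v) - 2)
          + p * (Δ NX NY : ℝ) * (2 * ∑ v, μ0 v * (W v * θ v) - ∑ a', utX a' * (W a' * θ a') - ∑ b', utY b' * (W b' * θ b'))) := by
  classical
  have hθm := theta_mem hW hp0 hp hθ
  -- `Δ = 1`
  have hD1 : (Δ NX NY : ℝ) = 1 := by exact_mod_cast adjacent_cdist_eq_one hΔ hab hX hY
  -- the optimal coupling's drift is the gain `G`
  set G : ℝ := ∑ w, utX w * (if NY w < NX w then (1 : ℝ) else 0) - ∑ w, utY w * (if NY w < NX w then (1 : ℝ) else 0)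
            - ∑ w, max (utY w - utX w) 0 * (if NX w = NY w then (1 : ℝ) else 0) with hGdef
  have hdrift : (Δ NX NY : ℝ) - ∑ a', ∑ b', optimalCoupling utX utY a' b' * (Δ (NX - Pi.single a' 1) (NY - Pi.single b' 1) : ℝ) = G := by
    rw [hubBracket_optimal hΔ NX NY (fun a' => NX - Pi.single a' 1) (fun b' => NY - Pi.single b' 1) hu0X hu0Y hu1X hu1Y
      (fun a' ha' => urnChain_survivor NX (hlegX a' ha')) (fun b' hb' => urnChain_survivor NY (hlegY b' hb')), hubGain_eq_posPart]
    ring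
  -- the cost inequality from domination (file 21) and `G ≥ x̃(★) ≥ 0`
  have hcost := adjacent_cost_le_gain_of_domination hW hp0 hp hθ hacc hK hNC hab hWab hX hY hz hPXoff hPXin hPXdiag hPXout hPXstay hPYoff hPYin hPYdiag hPYout hPYstay
    hKXoff hKXdiag hKYoff hKYdiag hσ0 hσ1 hxt hyt hxs hys hutX hutY hdom hDstar
  have hlX := lump_tail hW hacc hX hPXoff hPXin hPXdiag hPXout hPXstay hKXoff hKXdiag hK hNC hσ0 hσ1 hz hxt hutX
  have hlY := lump_tail hW hacc hY hPYoff hPYin hPYdiag hPYout hPYstay hKYoff hKYdiag hK hNC hσ0 hσ1 hz hyt hutY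
  have hxt0 : 0 ≤ xt none := by
    have hP0 := tagged_nonneg hW hacc hPXoff hPXin hPXdiag hPXout hPXstay hK hNC
    have hP1 := tagged_rowsum (P := PX) hPXdiag hPXstay
    exact geomResolvent_nonneg hP0 hP1 hσ0 hσ1 (ν := fun t => PX (some z) t) (fun t => hP0 _ _) hxt none
  have hG0 : 0 ≤ G := le_trans hxt0 (adjacent_gain_ge_of_domination hX hY hab hlX hlY (fun w _ _ => hdom w) (hdom a))
  -- `L ≤ Φ + e − 2` and `ρΦ ≤ 2σ·pE[Wθ]`
  have hθbar0 : 0 ≤ ∑ v, μ0 v * θ v := sum_nonneg fun v _ => mul_nonneg (hμ0 v) (by linarith [(hθm v).1])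
  have hMX := theta_mass_le hW hp0 hp hθ NX
  have hMY := theta_mass_le hW hp0 hp hθ NY
  have hsumX : ∑ v, (NX v : ℝ) = K + 1 := by
    have : ∑ v, NX v = K + 1 := by rw [hX]; simp only [Pi.add_apply]; rw [sum_add_distrib, hNC, Finset.sum_pi_single']; simp
    exact_mod_cast this
  have hsumY : ∑ v, (NY v : ℝ) = K + 1 := by
    have : ∑ v, NY v = K + 1 := by rw [hY]; simp only [Pi.add_apply]; rw [sum_add_distrib, hNC, Finset.sum_pi_single']; simp
    exact_mod_cast this
  have hsplit : ∑ v, θ v * ((NX v : ℝ) + (NY v : ℝ)) = ∑ v, θ v * (NX v : ℝ) + ∑ v, θ v * (NY v : ℝ) := by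
    rw [← sum_add_distrib]; exact sum_congr rfl fun v _ => by ring
  have hσθ : 0 ≤ σ * ∑ v, μ0 v * θ v := mul_nonneg hσ0 hθbar0
  have h1σθ : 0 ≤ (1 - σ) * θ z := mul_nonneg (by linarith) (by linarith [(hθm z).1])
  have h1σθ' : (1 - σ) * θ z ≤ 1 := by nlinarith [(hθm z).2, (hθm z).1]
  have hMX2 := hMX.2; have hMY2 := hMY.2; have hMX1 := hMX.1; have hMY1 := hMY.1
  rw [hsumX] at hMX2; rw [hsumY] at hMY2
  have hK0 : (0 : ℝ) ≤ K := Nat.cast_nonneg _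
  have hΦ' : Φ = c - 2 * ((1 - σ) * θ z) + (∑ v, θ v * (NX v : ℝ) + ∑ v, θ v * (NY v : ℝ)) := by rw [hΦ, hsplit]; ring
  have hL : 2 * (K : ℝ) + ∑ v, θ v * (NX v : ℝ) + ∑ v, θ v * (NY v : ℝ) ≤ Φ + (2 * (1 - σ) * θ z + 2 * σ * ∑ v, μ0 v * θ v) - 2 := by
    rw [hΦ']; linarith
  have hΦle : Φ ≤ c + 2 * K + 2 := by rw [hΦ']; linarith
  have hΦ0 : 0 ≤ Φ := by rw [hΦ']; linarith
  have hpers0 : 0 ≤ p * ∑ v, μ0 v * (W v * θ v) := mul_nonneg hp0 (sum_nonneg fun v _ => mul_nonneg (hμ0 v) (persist_nonneg hW hp0 hθ v))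
  have hρΦ : ρ * Φ ≤ 2 * σ * (p * ∑ v, μ0 v * (W v * θ v)) := le_trans (mul_le_mul_of_nonneg_left hΦle hρ0) hρ
  have hcrit := adjacent_persistence_criterion (μ0 := μ0) (utX := utX) (utY := utY) hW hp0 hθ hσ0 hG0 hcost hL hρΦ
  rw [hD1] at hdrift ⊢
  rw [hdrift]
  exact hcrit

end DominationCriterion

end Summit.Ventures.LatticeQCDFlow.Scaling
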